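import Literature.MathematicalPhysics.QuantumFieldTheory.Balaban1983to89.B9Thm311PosOfPrincipalAtLettersY
import Literature.MathematicalPhysics.QuantumFieldTheory.Balaban1983to89.B9Thm37CubeCoverCommutatorSizes
import Literature.MathematicalPhysics.QuantumFieldTheory.Balaban1983to89.B6TorusSiteWalks
import Literature.MathematicalPhysics.QuantumFieldTheory.Balaban1983to89.Node00.OpsYNablaBridge

/-!
# `Balaban1983to89.B9Thm311HessianWeightedLowerBoundY` — T. Bałaban, *Propagators for lattice gauge theories in a background field*, Commun. Math. Phys.
# **99** (1985) 389–434 [Balaban1985BackgroundPropagators], p. 392 (after (3.10)) and (3.69) p. 404: THE CURVATURE PART OF THE HESSIAN IS A SCALE-WEIGHTED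
# SMALL PERTURBATION — `⟨A, Δ(U)A⟩₁ ≥ −12(d+1)L²δ_h·Σ_b c_f²L^{−2j(b)}‖A(b)‖²_{HS}` whenever every plaquette obeys the LEVELLED window
# `‖U(∂p) − 1‖ ≤ δ_h·(L^{j(p)})⁻²` (`δ_h ≤ 1`); hence the same lower bound for `Δ_a(U) ≥ Δ(U)` — at def-Y's letters, for unitary-valued backgrounds
# (cell `pub-ymgap`, seat `dag-n06-j` gen 31; FILE B of the row-17 road «Thm 3.3 bounds + (3.69) ⇒ Thm 3.11 positivity»)

statement-level skeleton of published theorems with citation tags; proofs where landed; nothing here is a claim about the Yang–Mills mass gap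

THE PRINT.  p. 392, after (3.10): *«the operator Δ′ will be a bounded, small operator, which will be treated as a small perturbation of D\*D»*; (3.69)
p. 404: *«|(Δ′(U′U)A′)(b)| ≤ O(1)(Mα₀ + α₁)(Lʲη)⁻²|A′|, b ∈ Ω_j … This bound follows from the estimates |Re U(∂p) − 1| ≤ O(1)Mα₀(Lʲη)⁻², |Im U(∂p)| ≤
O(1)Mα₀(Lʲη)⁻² for p ⊂ Bʲ»*; [4] = [Balaban1984PropagatorsII] (2.2) p. 224 (adjacent sites differ by at most one level); (3.26) p. 395 (`Δ_a ≥ Δ(U)` as forms).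

WHY THIS FILE.  This lineage's g11 `B9Thm311PosOfPrincipalAtLettersY.trIP_hessY_ge` is the LOCAL form of (3.69) with print's position-dependent weights
(`Σ_p (1 − |Re U(∂p) − 1|)·HS((D_UA)(p)) − 3·Σ_p c_f²|Im U(∂p)|·Σ_{m<4} HS(A(b_m(p)))`); its uniform form used ONE `δ` for all plaquettes, which in lattice units
is useless across levels (`c_f²δ` is huge).  The class (3.35) gives the LEVELLED window `‖U(∂p) − 1‖ ≤ δ_h·(L^{j(p)})⁻²` (g24∕this gen
`B9Thm310DeltaAIsUnitOfRegYP335AtLettersY.norm_holY_sub_one_le_window_of_reg335P`), and the right currency is the SCALE-WEIGHTED form with the weight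
`w(b) = c_f²·L^{−2j(b)} = (L^{j(b)}η)⁻²` at the level `j(b) = levV1 b.src` of the bond: THIS FILE proves `⟨A, Δ(U)A⟩₁ ≥ −12(d+1)L²δ_h·Σ_b w(b)‖A(b)‖²_{HS}` — the
one extra geometric input being [4] (2.2): the edges of a plaquette have level at most one above the plaquette's (`levV1_shift_le_succ`, this lineage's g19
`B6TorusSiteWalks.lev_le_succ_of_torusSupNorm_le_one` + p38's `torusSupNorm_sub_tshift_le_one`), so `L^{−2j(p)} ≤ L²·L^{−2j(b_m(p))}`.  With g7's (3.26) form
inequality `⟨A, Δ(U)A⟩₁ ≤ ⟨A, Δ_a(U)A⟩₁` the bound passes to `Δ_a(U)`.  The companion files turn it, together with Theorem 3.3's bounds on `G = Δ_a⁻¹`, into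
positivity of `Δ_a(U)` (the spectral-gap engine `B9Thm311PosDefViaSpectralGap`).

WHAT IS PROVED (sorry-free; 0 `def`; no inequality of the paper asserted beyond what is proved).
* §1 `levV1_shift_le_succ` (`lev(x + e_μ) ≤ lev(x) + 1`, [4] (2.2)), `levV1_edgeY_src_le_succ` (every edge of a plaquette is based at a site of level
  `≤ j(p) + 1`), `pow_lev_edgeY_le` (`L^{j(b_m(p))} ≤ L·L^{j(p)}`), `inv_pow_lev_sq_le` (`(L^{j(p)})⁻² ≤ L²·(L^{j(b_m(p))})⁻²`).
* §2 ★★ `trIP_hessY_ge_neg_weighted` — unitary-valued `U`, `0 ≤ δ_h ≤ 1`, levelled window ⟹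
  `−(12(d+1)·L²·δ_h)·Σ_b (c_f²·((L^{levV1 b.src})⁻¹)²)·Σ_{ac}‖A(b)_{ac}‖² ≤ ⟨A, Δ(U)A⟩₁`;
  ★★ `trIP_deltaAY_ge_neg_weighted` — the same lower bound for `⟨A, Δ_a(U)A⟩₁` at def-Y's letters `parSymY ∕ parBY ∕ GpY` for `G`-valued `U`, `G ≤ U(N)`.
HONEST SCOPE.  Elementary bookkeeping over this lineage's landed (3.69) file and g7's (3.26) file; the levelled window is a HYPOTHESIS here (a theorem of the class
in the companion file); NOT a node discharge; count-neutral; nothing continuum ∕ OS ∕ mass gap ∕ Clay.  Cell `pub-ymgap` (HUMAN RULING D-0062), node N06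
[B9], seat `pub-ymgap-dag-n06-j` (harness re-seat gen 31), 2026-08-29.  No `sorry`, no `axiom`, no `instance`, no `notation`, no `def`.  NEW file.
-/

noncomputable section

namespace Literature.MathematicalPhysics.QuantumFieldTheory.Balaban1983to89.B9Thm311HessianWeightedLowerBoundY

open Literature.MathematicalPhysics.QuantumFieldTheory.Balaban1983to89
open B9Thm311ReadingCoords B9Thm311ProjectionR B9Ineq369CurvatureSmallAtLettersY B9Thm311PosOfPrincipalAtLettersY Node00
open B6KLevelCensusIndexV1 B6GlobalChartV1 B9BackgroundsKLevelV1
open Literature.MathematicalPhysics.QuantumFieldTheory.Balaban1983to89.B6MultiLevelTorusOperator (tshift unitVec)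
open Literature.MathematicalPhysics.QuantumFieldTheory.Balaban1983to89.B4TorusKernel.MultiPeriod (torusSupNorm)
open scoped Matrix Matrix.Norms.L2Operator

variable {d ℓ : ℕ} {hd : 1 ≤ d + 1} {hL : Odd (ℓ + 1) ∧ 1 < ℓ + 1} {b₀ b₁ : ℝ}
variable (i : KIdx d ℓ hd hL b₀ b₁) {N : ℕ}

/-! ## §1 [4] (2.2): the edges of a plaquette live at most one level above it -/

/-- **adjacent sites differ by at most one level**: `lev(x + e_μ) ≤ lev(x) + 1` ((2.2): level-`j−1` and level-`j+1` territory are `> R·M·Lʲ` apart).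
[cite: Balaban1984PropagatorsII, (2.2) p.224] -/
theorem levV1_shift_le_succ (x : Site (PV d ℓ i.m i.K hd hL) 0) (μ : Fin (d + 1)) : levV1 i (x.shift μ) ≤ levV1 i x + 1 := by
  have hR : 1 ≤ i.R := le_trans (Nat.one_le_iff_ne_zero.2 (Nat.mul_ne_zero_iff.2 ⟨by norm_num, (Nat.pow_pos (by omega)).ne'⟩)) i.hR2
  have hMh : 1 ≤ i.Mh := le_trans (by norm_num) i.hM8
  have h1 : torusSupNorm (B6MultiLevelBoxOperator.N0 ℓ i.Mh i.k i.P') ((OpsYNablaBridge.chartY i x).1 - (shiftY i μ (OpsYNablaBridge.chartY i x)).1) ≤ 1 := by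
    have e : shiftY i μ (OpsYNablaBridge.chartY i x) = tshift (toKT i).NB ((1 : ℤ) • unitVec μ) (OpsYNablaBridge.chartY i x) := by rw [one_smul]; rfl
    rw [e]
    exact B9Thm37CubeCoverCommutatorSizes.torusSupNorm_sub_tshift_le_one _ μ 1 (Or.inl rfl)
  have h := B6TorusSiteWalks.lev_le_succ_of_torusSupNorm_le_one i.D hR hMh h1
  rw [OpsYNablaBridge.shiftY_chartY] at h
  exact h

/-- the four edges of a plaquette `p` are based at `p.src`, `p.src + e_μ` or `p.src + e_ν`, so their level is `≤ levV1 p.src + 1`.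
[cite: Balaban1984PropagatorsII, (2.2) p.224; Balaban1985BackgroundPropagators, (3.2) p.390 (the plaquette contour)] -/
theorem levV1_edgeY_src_le_succ (p : PlaqY i) (m : Fin 4) : levV1 i (edgeY i p m).src ≤ levV1 i p.src + 1 := by
  fin_cases m
  · exact levV1_shift_le_succ i p.src p.ν
  · show levV1 i p.src ≤ levV1 i p.src + 1; omega
  · show levV1 i p.src ≤ levV1 i p.src + 1; omega
  · exact levV1_shift_le_succ i p.src p.μ

/-- `L^{j(b_m(p))} ≤ L·L^{j(p)}`. [cite: Balaban1984PropagatorsII, (2.2) p.224, bookkeeping] -/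
theorem pow_lev_edgeY_le (p : PlaqY i) (m : Fin 4) :
    ((ℓ : ℝ) + 1) ^ levV1 i (edgeY i p m).src ≤ ((ℓ : ℝ) + 1) * ((ℓ : ℝ) + 1) ^ levV1 i p.src := by
  rw [← pow_succ']
  exact pow_le_pow_right₀ (by have : (0:ℝ) ≤ ℓ := Nat.cast_nonneg _; linarith) (by have := levV1_edgeY_src_le_succ i p m; omega)

/-- `(L^{j(p)})⁻² ≤ L²·(L^{j(b_m(p))})⁻²`. [cite: Balaban1984PropagatorsII, (2.2) p.224, bookkeeping] -/
theorem inv_pow_lev_sq_le (p : PlaqY i) (m : Fin 4) :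
    ((((ℓ : ℝ) + 1) ^ levV1 i p.src)⁻¹) ^ 2 ≤ ((ℓ : ℝ) + 1) ^ 2 * ((((ℓ : ℝ) + 1) ^ levV1 i (edgeY i p m).src)⁻¹) ^ 2 := by
  have hL : (0 : ℝ) < (ℓ : ℝ) + 1 := by have : (0:ℝ) ≤ ℓ := Nat.cast_nonneg _; linarith
  have ha : (0 : ℝ) < ((ℓ : ℝ) + 1) ^ levV1 i p.src := pow_pos hL _
  have hb : (0 : ℝ) < ((ℓ : ℝ) + 1) ^ levV1 i (edgeY i p m).src := pow_pos hL _
  have h := pow_lev_edgeY_le i p m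
  have h1 : (((ℓ : ℝ) + 1) ^ levV1 i p.src)⁻¹ ≤ ((ℓ : ℝ) + 1) * (((ℓ : ℝ) + 1) ^ levV1 i (edgeY i p m).src)⁻¹ := by
    rw [le_mul_inv_iff₀ hb, inv_mul_le_iff₀ ha]
    linarith
  calc ((((ℓ : ℝ) + 1) ^ levV1 i p.src)⁻¹) ^ 2 ≤ (((ℓ : ℝ) + 1) * (((ℓ : ℝ) + 1) ^ levV1 i (edgeY i p m).src)⁻¹) ^ 2 :=
        pow_le_pow_left₀ (inv_nonneg.2 ha.le) h1 2
    _ = ((ℓ : ℝ) + 1) ^ 2 * ((((ℓ : ℝ) + 1) ^ levV1 i (edgeY i p m).src)⁻¹) ^ 2 := by rw [mul_pow]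

/-! ## §2 The scale-weighted (3.69) lower bound of the Hessian, and of `Δ_a(U)` -/

/-- ★★ **THE CURVATURE PART IS A SCALE-WEIGHTED SMALL PERTURBATION**: at a unitary-valued background whose plaquettes obey the levelled window
`‖U(∂p) − 1‖ ≤ δ_h·((L^{j(p)})⁻¹)²` (`j(p) = levV1 p.src`, `0 ≤ δ_h ≤ 1`),
`−(12(d+1)·L²·δ_h)·Σ_b c_f²((L^{j(b)})⁻¹)²‖A(b)‖²_{HS} ≤ ⟨A, Δ(U)A⟩₁` (`j(b) = levV1 b.src`). [cite: Balaban1985BackgroundPropagators, (3.69) p.404, p.392; Balaban1984PropagatorsII, (2.2) p.224] -/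
theorem trIP_hessY_ge_neg_weighted {U : CfgY (Matrix (Fin N) (Fin N) ℂ) i}
    (hU : ∀ μ x, ((U μ x : (Matrix (Fin N) (Fin N) ℂ)ˣ) : Matrix (Fin N) (Fin N) ℂ) ∈ unitary (Matrix (Fin N) (Fin N) ℂ)) {δh : ℝ} (hδh0 : 0 ≤ δh)
    (hδh1 : δh ≤ 1) (hplaq : ∀ p : PlaqY i, ‖((holY i U p : (Matrix (Fin N) (Fin N) ℂ)ˣ) : Matrix (Fin N) (Fin N) ℂ) - 1‖ ≤
      δh * ((((ℓ : ℝ) + 1) ^ levV1 i p.src)⁻¹) ^ 2) (A : FBondY i → Matrix (Fin N) (Fin N) ℂ) :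
    -(12 * ((d : ℝ) + 1) * ((ℓ : ℝ) + 1) ^ 2 * δh) *
        ∑ b : FBondY i, (i.cf ^ 2 * ((((ℓ : ℝ) + 1) ^ levV1 i b.src)⁻¹) ^ 2) * ∑ a, ∑ c, ‖A b a c‖ ^ 2
      ≤ trIP (fun _ => (1 : ℝ)) A (hessY i U A) := by
  have h0 := trIP_hessY_ge i hU A
  -- the window at one plaquette is at most `δ_h ≤ 1`
  have hwin1 : ∀ p : PlaqY i, ‖((holY i U p : (Matrix (Fin N) (Fin N) ℂ)ˣ) : Matrix (Fin N) (Fin N) ℂ) - 1‖ ≤ 1 := by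
    intro p
    refine (hplaq p).trans ?_
    have hL1 : (1 : ℝ) ≤ ((ℓ : ℝ) + 1) ^ levV1 i p.src := one_le_pow₀ (by have : (0:ℝ) ≤ ℓ := Nat.cast_nonneg _; linarith)
    have : ((((ℓ : ℝ) + 1) ^ levV1 i p.src)⁻¹) ^ 2 ≤ 1 := by
      rw [inv_pow]; exact inv_le_one_of_one_le₀ (one_le_pow₀ hL1)
    nlinarith
  -- the Jordan part is non-negative
  have hJ : 0 ≤ ∑ p : PlaqY i, (1 - ‖reHolY i U p - 1‖) * ∑ a, ∑ b, ‖curlY i U A p a b‖ ^ 2 :=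
    Finset.sum_nonneg fun p _ => mul_nonneg (by linarith [norm_reHolY_sub_one_le i U hU (hwin1 p)]) (hs_nonneg _)
  -- the commutator part, edge by edge, against the weight at the edge
  set w : FBondY i → ℝ := fun b => i.cf ^ 2 * ((((ℓ : ℝ) + 1) ^ levV1 i b.src)⁻¹) ^ 2 with hw
  have hwnn : ∀ b, 0 ≤ w b := fun b => by rw [hw]; positivity
  have hC : ∑ p : PlaqY i, i.cf ^ 2 * ‖imHolY i U p‖ * ∑ m : Fin 4, ∑ a, ∑ b, ‖A (edgeY i p m) a b‖ ^ 2 ≤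
      ∑ p : PlaqY i, ∑ m : Fin 4, (((ℓ : ℝ) + 1) ^ 2 * δh) * (w (edgeY i p m) * ∑ a, ∑ b, ‖A (edgeY i p m) a b‖ ^ 2) := by
    refine Finset.sum_le_sum fun p _ => ?_
    rw [Finset.mul_sum]
    refine Finset.sum_le_sum fun m _ => ?_
    have him := norm_imHolY_le i U hU (hplaq p)
    have hsq := inv_pow_lev_sq_le i p m
    have hHS := hs_nonneg (A (edgeY i p m))
    have hcf : 0 ≤ i.cf ^ 2 := sq_nonneg _
    have h1 : i.cf ^ 2 * ‖imHolY i U p‖ ≤ (((ℓ : ℝ) + 1) ^ 2 * δh) * w (edgeY i p m) := by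
      rw [hw]
      calc i.cf ^ 2 * ‖imHolY i U p‖ ≤ i.cf ^ 2 * (δh * ((((ℓ : ℝ) + 1) ^ levV1 i p.src)⁻¹) ^ 2) := mul_le_mul_of_nonneg_left him hcf
        _ ≤ i.cf ^ 2 * (δh * (((ℓ : ℝ) + 1) ^ 2 * ((((ℓ : ℝ) + 1) ^ levV1 i (edgeY i p m).src)⁻¹) ^ 2)) :=
            mul_le_mul_of_nonneg_left (mul_le_mul_of_nonneg_left hsq hδh0) hcf
        _ = (((ℓ : ℝ) + 1) ^ 2 * δh) * (i.cf ^ 2 * ((((ℓ : ℝ) + 1) ^ levV1 i (edgeY i p m).src)⁻¹) ^ 2) := by ring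
    calc i.cf ^ 2 * ‖imHolY i U p‖ * ∑ a, ∑ b, ‖A (edgeY i p m) a b‖ ^ 2
        ≤ ((((ℓ : ℝ) + 1) ^ 2 * δh) * w (edgeY i p m)) * ∑ a, ∑ b, ‖A (edgeY i p m) a b‖ ^ 2 := mul_le_mul_of_nonneg_right h1 hHS
      _ = (((ℓ : ℝ) + 1) ^ 2 * δh) * (w (edgeY i p m) * ∑ a, ∑ b, ‖A (edgeY i p m) a b‖ ^ 2) := by ring
  have hE := sum_edgeY_le i (g := fun b => w b * ∑ a, ∑ c, ‖A b a c‖ ^ 2) fun b => mul_nonneg (hwnn b) (hs_nonneg _)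
  have hC' : ∑ p : PlaqY i, ∑ m : Fin 4, (((ℓ : ℝ) + 1) ^ 2 * δh) * (w (edgeY i p m) * ∑ a, ∑ b, ‖A (edgeY i p m) a b‖ ^ 2)
      = (((ℓ : ℝ) + 1) ^ 2 * δh) * ∑ p : PlaqY i, ∑ m : Fin 4, (w (edgeY i p m) * ∑ a, ∑ b, ‖A (edgeY i p m) a b‖ ^ 2) := by
    rw [Finset.mul_sum]
    refine Finset.sum_congr rfl fun p _ => ?_
    rw [Finset.mul_sum]
  have hc0 : 0 ≤ ((ℓ : ℝ) + 1) ^ 2 * δh := by positivity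
  have hE' := mul_le_mul_of_nonneg_left hE hc0
  rw [hC'] at hC
  have hfin : 3 * ∑ p : PlaqY i, i.cf ^ 2 * ‖imHolY i U p‖ * ∑ m : Fin 4, ∑ a, ∑ b, ‖A (edgeY i p m) a b‖ ^ 2 ≤
      (12 * ((d : ℝ) + 1) * ((ℓ : ℝ) + 1) ^ 2 * δh) * ∑ b : FBondY i, w b * ∑ a, ∑ c, ‖A b a c‖ ^ 2 := by
    have := hC.trans hE'
    nlinarith [this]
  linarith [h0, hJ, hfin]

/-- ★★ **THE SAME LOWER BOUND FOR `Δ_a(U)`** at def-Y's letters of record (`parSymY ∕ parBY ∕ GpY parSymY`), `U` `G`-valued with `G ≤ U(N)`: by (3.26) as forms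
(`Δ_a(U) ≥ Δ(U)`, this lineage's g7 `trIP_hessY_le_trIP_deltaAY`). [cite: Balaban1985BackgroundPropagators, (3.26) p.395, (3.69) p.404, Thm 3.11 p.416] -/
theorem trIP_deltaAY_ge_neg_weighted {G : Subgroup (Matrix (Fin N) (Fin N) ℂ)ˣ} (hG : G ≤ B7Prop2Explicit.unitaryUnits (Matrix (Fin N) (Fin N) ℂ))
    {U : CfgY (Matrix (Fin N) (Fin N) ℂ) i} (hU : ∀ μ x, U μ x ∈ G) {δh : ℝ} (hδh0 : 0 ≤ δh) (hδh1 : δh ≤ 1)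
    (hplaq : ∀ p : PlaqY i, ‖((holY i U p : (Matrix (Fin N) (Fin N) ℂ)ˣ) : Matrix (Fin N) (Fin N) ℂ) - 1‖ ≤
      δh * ((((ℓ : ℝ) + 1) ^ levV1 i p.src)⁻¹) ^ 2) (A : FBondY i → Matrix (Fin N) (Fin N) ℂ) :
    -(12 * ((d : ℝ) + 1) * ((ℓ : ℝ) + 1) ^ 2 * δh) *
        ∑ b : FBondY i, (i.cf ^ 2 * ((((ℓ : ℝ) + 1) ^ levV1 i b.src)⁻¹) ^ 2) * ∑ a, ∑ c, ‖A b a c‖ ^ 2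
      ≤ trIP (fun _ => (1 : ℝ)) A (deltaAY i (parSymY i) (parBY i) (GpY i (parSymY i)) U A) := by
  have hU' : ∀ μ x, ((U μ x : (Matrix (Fin N) (Fin N) ℂ)ˣ) : Matrix (Fin N) (Fin N) ℂ) ∈ unitary (Matrix (Fin N) (Fin N) ℂ) :=
    fun μ x => hG (hU μ x)
  exact (trIP_hessY_ge_neg_weighted i hU' hδh0 hδh1 hplaq A).trans (trIP_hessY_le_trIP_deltaAY i hG hU A)

end Literature.MathematicalPhysics.QuantumFieldTheory.Balaban1983to89.B9Thm311HessianWeightedLowerBoundY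

end
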